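import Literature.MathematicalPhysics.StatisticalMechanics.GridEdgeIsoperimetry
import HarnessLib

/-!
# Deficient boxes are not edge-isoperimetric minimizers (Mainini–Schmidt 2020, Lemma 3.6 — the
# converse slab lemma — in every dimension)

Topic `Literature/MathematicalPhysics/StatisticalMechanics`; continues `GridEdgeIsoperimetry.lean`
(`EIP^d = cubicleCost d` and nested `EIP^d` solutions in every dimension) and complements
`EIPSlabMinimizers.lean` ([MS20] Lemma 3.5: the slab-deficient cube `P_{ℓ,d,p}` IS a minimizer for
`p ≤ ⌊h_{ℓ,d}⌋`).  Everything here is PROVED; no named facts are introduced.  This is the second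
ingredient (after `EIPMinimizerExtent.lean`) of the printed proof of the last undischarged fact of
`EdgeIsoperimetricFluctuations.lean`, `MaininiSchmidt2020_thm11_upper` ([MS20] Theorem 1.1 (i)):
Corollary 4.8 of [MS20] applies Lemma 3.6 in dimension `d − 1` to the top face of the rearranged
minimizer.

## The statement ([MS20] Lemma 3.6, tex chunk p0011 of `paper:arxiv-2003.01679`)

"Let `d ∈ {2,3,…}`. Let `ℓ ∈ ℕ` and `j ∈ {0, …, d−1}`. The configuration
`P_{ℓ,j,d,2p} := {1,…,ℓ−2p} × {1,…,ℓ+1}^j × {1,…,ℓ}^{d−1−j}` is not an `EIP^d` minimizer if `p ∈ ℕ` is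
such that `2p ≥ 4^{c_d} h_{ℓ,d}`, where `c_d := 1 − 2^{1−d}`" (and `h_{ℓ,d} = ℓ^{2^{1−d}}`,
Definition 3.1).  Typed as `not_isEIPMinimizer_deficientBox` (dimension `d = m + 2`, the box
`deficientBox m ℓ j (2p)`, threshold `slabThreshold d ℓ = 4^{1−2^{1−d}} ℓ^{2^{1−d}}`), with the
hypothesis `2p < ℓ` added: for `2p ≥ ℓ` the printed set is EMPTY and hence a minimizer by the
convention of [MS20] §1, so the literal statement is false there (noted by the typing seat of
`EdgeIsoperimetricFluctuations.lean`, which did not vendor Lemma 3.6 for this reason); `p ≥ 1` is the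
source's `ℕ = {1,2,…}`; `j` is unrestricted (for `j ≥ d − 1` all long edges are `ℓ + 1`, still
covered by the same proof).  The `j = 0` case in the vocabulary of the row file:
`not_isEIPMinimizer_slabConfig_of_le` (`slabConfig d ℓ (2p)`).

## The proof ([MS20] pp. 11–12), in VALUE form

[MS20] rearranges `P = P_{ℓ,j,d,2p}` without changing the edge perimeter: `P'` (the slab
`{1,…,ℓ−2p} × {ℓ̃−p+1,…,ℓ̃} × H` of thickness `p` is cut from the long side `ℓ̃ ∈ {ℓ, ℓ+1}` and glued
onto the short face), then `P''` (`p(p−1)` sections of dimension `d − 2` are moved one by one from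
the protruding layer into the corner), and observes that the face
`{1,…,ℓ−2p−p(p−1)} × H` of `P''` is the deficient box `P_{ℓ,j',d−1,p²+p}` one dimension down, which
by induction is not an `EIP^{d−1}` minimizer since `p(p+1) ≥ p² ≥ 4^{c_{d−1}} h_{ℓ,d−1}`
(`c_{d−1} + 1 = 2c_d`, `h_{ℓ,d−1} = h_{ℓ,d}²`); by Corollary 3.3 `P''`, hence `P`, is not a minimizer.
Here (as in `EIPSlabMinimizers.lean` for Lemma 3.5) the rearranged SET is replaced by the COST of a
sorted stack (`EIPSliceRecursion.eipValue_succ_le_profileCost` over the nested minimizers of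
`GridEdgeIsoperimetry.exists_isNestedMinimizerFamily`): the `e_2`-sections of `P''`, sorted, are
`ℓ−p−1` boxes `{1,…,ℓ−p} × H`, `ℓ̃ − ℓ` boxes `{1,…,ℓ−2p} × H` and ONE box `{1,…,ℓ−p−p²} × H`
(`blockProfile`); bounding the `EIP^{d−1}`-value of each level by the perimeter of the corresponding
box (`card_boundaryPairs_boxConfig_cons`) gives EXACTLY `#Θ_d(P)` (`deficient_arith₂` — this identity
is the printed "edge-perimeter preserving"), and the induction hypothesis makes the last level, hence
the total, STRICTLY smaller: `EIP^d(#P) < #Θ_d(P)` (`eipValue_deficientBox_lt`).  The base `d = 2`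
("`D = {1,…,ℓ−p} × {1,…,ℓ̃−p−1}` … for `p ≥ √ℓ`") and the degenerate case "`ℓ − 2p − p(p−1) < 1`"
of the printed proof are both the planar comparison `eipValue_two_rect_lt`
(`2⌈2√(ab)⌉ ≤ 2(a+b) − 2` for the rectangle `a × b`, `b = a + 2p + ε`, `a + p ≤ p²`, via the tree's
`halfPerim_le_iff`) stacked over `H` (`eipValue_deficientBox_lt_of_le`).  The exponent bookkeeping
is `slabThreshold_succ_sq` (`(4^{c_{d+1}} h_{ℓ,d+1})² = 4 · 4^{c_d} h_{ℓ,d}`),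
`slabThreshold_le_of_succ`, `le_sq_of_slabThreshold_two_le`.

Also proved (section `Box`, reusable): lattice boxes `boxConfig n s = ∏_i {1,…,s_i}` in every
dimension with `card_boxConfig`, `sliceAt_boxConfig_succ`, `firstCoords_boxConfig_succ` and the
perimeter recursion `card_boundaryPairs_boxConfig_succ` / `_cons`
(`#Θ_{n+1}(∏{1,…,s_i}) = 2·#B + s_0·#Θ_n(B)`, `B` the cross-section), generalising
`EIPSlabMinimizers.card_boundaryPairs_slabConfig_succ`.

## References

* [MS20] E. Mainini, B. Schmidt, *Maximal fluctuations around the Wulff shape for edge-isoperimetric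
  sets in ℤ^d: a sharp scaling law*, Comm. Math. Phys. 380 (2020) 947–971 = arXiv:2003.01679
  [MaininiSchmidt2020] (store key `paper:arxiv-2003.01679`): Definition 3.1, Lemma 3.5, Lemma 3.6
  (chunk p0011), Proposition 3.2, Corollary 3.3.
-/

noncomputable section

open Finset

namespace Literature.MathematicalPhysics.StatisticalMechanics

open Literature.Probability.LatticeModels

/-! ### Lattice boxes `∏_i {1,…,s_i}` in every dimension: slices, cardinality, perimeter -/

section Box

variable {n : ℕ}

/-- The lattice box `∏_{i<n} {1, …, s_i} ⊂ ℤ^n` with edges `s : Fin n → ℕ` (the sets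
`{1,…,a_1} × ⋯ × {1,…,a_d}` of [MS20] §3–§4: `P_{ℓ,d,p}`, `P_{ℓ,j,d,2p}`, the minimal rectangle).
[cite: MaininiSchmidt2020, Lemma 3.6 (P_{ℓ,j,d,2p}) and Definition 4.6] -/
def boxConfig (n : ℕ) (s : Fin n → ℕ) : Finset (Site n) :=
  Fintype.piFinset fun i => Icc (1 : ℤ) (s i)

/-- Membership in a box. [cite: MaininiSchmidt2020, Lemma 3.6 (P_{ℓ,j,d,2p})] -/
theorem mem_boxConfig {s : Fin n → ℕ} {x : Site n} :
    x ∈ boxConfig n s ↔ ∀ i, 1 ≤ x i ∧ x i ≤ s i := by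
  unfold boxConfig
  rw [Fintype.mem_piFinset]
  exact forall_congr' fun i => mem_Icc

/-- `#∏{1,…,s_i} = ∏ s_i`. [cite: MaininiSchmidt2020, Lemma 3.6 (#P_{ℓ,j,d,2p})] -/
theorem card_boxConfig (s : Fin n → ℕ) : #(boxConfig n s) = ∏ i, s i := by
  unfold boxConfig
  rw [Fintype.card_piFinset]
  exact prod_congr rfl fun i _ => by simp

/-- In dimension `0` the box is the one-point set `ℤ⁰`. [cite: MaininiSchmidt2020, §1 (d ∈ ℕ)] -/
theorem card_boxConfig_zero (s : Fin 0 → ℕ) : #(boxConfig 0 s) = 1 := by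
  rw [card_boxConfig]; rfl

/-- `ℤ⁰` has no edges: every subset has edge perimeter `0`. [cite: MaininiSchmidt2020, §1 (Θ_d)] -/
theorem card_boundaryPairs_site_zero' (A : Finset (Site 0)) : #(boundaryPairs A) = 0 := by
  rw [card_eq_zero, boundaryPairs, (univ_eq_empty : (univ : Finset (Fin 0 × Bool)) = ∅),
    product_empty, filter_empty]

/-- The slices of a box across the first axis are the boxes `∏_{i≥1}{1,…,s_i}` at heights
`1, …, s_0` and empty elsewhere. [cite: MaininiSchmidt2020, Proposition 3.2 (sections S_{s,k})] -/
theorem sliceAt_boxConfig_succ (s : Fin (n + 1) → ℕ) (t : ℤ) :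
    sliceAt (boxConfig (n + 1) s) t =
      if 1 ≤ t ∧ t ≤ s 0 then boxConfig n (Fin.tail s) else ∅ := by
  ext y
  rw [mem_sliceAt, mem_boxConfig, Fin.forall_fin_succ]
  simp only [Fin.cons_zero, Fin.cons_succ]
  split_ifs with ht
  · rw [mem_boxConfig]
    exact ⟨fun h => h.2, fun h => ⟨ht, h⟩⟩
  · simp only [notMem_empty, iff_false, not_and]
    exact fun h _ => ht h

/-- The occupied heights of a box with all edges `≥ 1` are `1, …, s_0`.
[cite: MaininiSchmidt2020, Proposition 3.2 (the set K_s)] -/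
theorem firstCoords_boxConfig_succ {s : Fin (n + 1) → ℕ} (hs : ∀ i, 1 ≤ s i) :
    firstCoords (boxConfig (n + 1) s) = Icc (1 : ℤ) (s 0) := by
  ext t
  have hne : (boxConfig n (Fin.tail s)).Nonempty := by
    rw [← card_pos, card_boxConfig]
    exact prod_pos fun i _ => hs i.succ
  constructor
  · intro ht
    have h := sliceAt_nonempty ht
    rw [sliceAt_boxConfig_succ] at h
    split_ifs at h with h'
    · exact mem_Icc.2 h'
    · exact absurd h (not_nonempty_empty)
  · intro ht
    obtain ⟨y, hy⟩ := hne
    have : y ∈ sliceAt (boxConfig (n + 1) s) t := by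
      rw [sliceAt_boxConfig_succ, if_pos (mem_Icc.1 ht)]; exact hy
    exact mem_image.2 ⟨_, mem_sliceAt.1 this, Fin.cons_zero _ _⟩

/-- **Perimeter recursion for boxes**: `#Θ_{n+1}(∏_{i≤n}{1,…,s_i}) = 2·#B + s_0·#Θ_n(B)` with
`B = ∏_{i≥1}{1,…,s_i}` (all `s_i ≥ 1`): `s_0` equal slices plus the two end faces — the slice
decomposition of [MS20] Proposition 3.2 for a box. [cite: MaininiSchmidt2020, Proposition 3.2 (horizontal/vertical bond counts) and Lemma 3.6 (Θ of boxes)] -/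
theorem card_boundaryPairs_boxConfig_succ {s : Fin (n + 1) → ℕ} (hs : ∀ i, 1 ≤ s i) :
    #(boundaryPairs (boxConfig (n + 1) s)) =
      2 * #(boxConfig n (Fin.tail s)) + s 0 * #(boundaryPairs (boxConfig n (Fin.tail s))) := by
  set P := boxConfig (n + 1) s with hP
  set B := boxConfig n (Fin.tail s) with hB
  have h0 : 1 ≤ s 0 := hs 0
  rw [card_boundaryPairs_eq_sum_sliceAt_add P, card_vertBoundaryPairs_eq_sum P,
    card_vertBoundaryPairs_eq_sum P, firstCoords_boxConfig_succ hs]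
  simp only [if_true, Bool.false_eq_true, if_false]
  have hsl : ∀ t ∈ Finset.Icc (1 : ℤ) (s 0), sliceAt P t = B := fun t ht => by
    rw [hP, sliceAt_boxConfig_succ, if_pos (mem_Icc.1 ht)]
  have h1 : ∑ t ∈ Finset.Icc (1 : ℤ) (s 0), #(boundaryPairs (sliceAt P t)) =
      s 0 * #(boundaryPairs B) := by
    rw [sum_congr rfl fun t ht => by rw [hsl t ht], sum_const, Int.card_Icc, smul_eq_mul]
    congr 1
    omega
  have h2 : ∑ t ∈ Finset.Icc (1 : ℤ) (s 0), #(sliceAt P t \ sliceAt P (t + 1)) = #B := by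
    have : ∀ t ∈ Finset.Icc (1 : ℤ) (s 0),
        #(sliceAt P t \ sliceAt P (t + 1)) = if t = s 0 then #B else 0 := by
      intro t ht
      rw [mem_Icc] at ht
      rw [hsl t (mem_Icc.2 ht), hP, sliceAt_boxConfig_succ]
      split_ifs with h' h''
      · exfalso; omega
      · simp [hB]
      · rw [sdiff_empty]
      · exfalso; omega
    rw [sum_congr rfl this, sum_ite_eq', if_pos (mem_Icc.2 ⟨by omega, le_rfl⟩)]
  have h3 : ∑ t ∈ Finset.Icc (1 : ℤ) (s 0), #(sliceAt P t \ sliceAt P (t + -1)) = #B := by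
    have : ∀ t ∈ Finset.Icc (1 : ℤ) (s 0),
        #(sliceAt P t \ sliceAt P (t + -1)) = if t = 1 then #B else 0 := by
      intro t ht
      rw [mem_Icc] at ht
      rw [hsl t (mem_Icc.2 ht), hP, sliceAt_boxConfig_succ]
      split_ifs with h' h''
      · exfalso; omega
      · simp [hB]
      · rw [sdiff_empty]
      · exfalso; omega
    rw [sum_congr rfl this, sum_ite_eq', if_pos (mem_Icc.2 ⟨le_rfl, by omega⟩)]
  rw [h1, h2, h3]
  ring

/-- A box with first edge `w ≥ 1` over a base box `H` (all edges `≥ 1`): cardinality `w·#H` and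
perimeter `2·#H + w·#Θ(H)`, in the `Fin.cons` form used below.
[cite: MaininiSchmidt2020, Lemma 3.6 (the sets {1,…,w} × H)] -/
theorem card_boxConfig_cons (w : ℕ) (h : Fin n → ℕ) :
    #(boxConfig (n + 1) (Fin.cons w h)) = w * #(boxConfig n h) := by
  rw [card_boxConfig, card_boxConfig, Fin.prod_univ_succ, Fin.cons_zero]
  rfl

/-- Perimeter of `{1,…,w} × H` for a base box `H` with all edges `≥ 1` and `w ≥ 1`:
`2·#H + w·#Θ(H)`. [cite: MaininiSchmidt2020, Lemma 3.6 (the sets {1,…,w} × H) and Proposition 3.2] -/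
theorem card_boundaryPairs_boxConfig_cons {w : ℕ} (hw : 1 ≤ w) {h : Fin n → ℕ}
    (hh : ∀ i, 1 ≤ h i) :
    #(boundaryPairs (boxConfig (n + 1) (Fin.cons w h))) =
      2 * #(boxConfig n h) + w * #(boundaryPairs (boxConfig n h)) := by
  have hs : ∀ i : Fin (n + 1), 1 ≤ (Fin.cons w h : Fin (n + 1) → ℕ) i :=
    Fin.cases (by simpa using hw) (fun i => by simpa using hh i)
  rw [card_boundaryPairs_boxConfig_succ hs, Fin.tail_cons, Fin.cons_zero]

end Box


/-! ### The threshold `4^{c_d} h_{ℓ,d}` of [MS20] Lemma 3.6 (`c_d = 1 − 2^{1−d}`, `h_{ℓ,d} = ℓ^{2^{1−d}}`) -/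

section Threshold

/-- The threshold `4^{c_d} · h_{ℓ,d} = 4^{1 − 2^{1−d}} · ℓ^{2^{1−d}}` of [MS20] Lemma 3.6
(`h_{ℓ,d}` = Definition 3.1, `c_d := 1 − 2^{1−d}`). [cite: MaininiSchmidt2020, Lemma 3.6 and Definition 3.1] -/
def slabThreshold (d ℓ : ℕ) : ℝ :=
  (4 : ℝ) ^ (1 - (2 : ℝ) ^ (1 - (d : ℝ))) * (ℓ : ℝ) ^ ((2 : ℝ) ^ (1 - (d : ℝ)))

/-- `4^{c_d} h_{ℓ,d} ≥ 0`. [cite: MaininiSchmidt2020, Lemma 3.6] -/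
theorem slabThreshold_nonneg (d ℓ : ℕ) : 0 ≤ slabThreshold d ℓ := by
  unfold slabThreshold; positivity

/-- **The exponent bookkeeping of [MS20] Lemma 3.6**: `(4^{c_{d+1}} h_{ℓ,d+1})² = 4 · 4^{c_d} h_{ℓ,d}`,
i.e. the printed relations `c_{d−1} + 1 = 2c_d` and `h_{ℓ,d−1} = h_{ℓ,d}²`.
[cite: MaininiSchmidt2020, Lemma 3.6 (proof: "since c_{d−1}+1 = 2c_d and h_{ℓ,d−1} = h²_{ℓ,d}")] -/
theorem slabThreshold_succ_sq (d ℓ : ℕ) : slabThreshold (d + 1) ℓ ^ 2 = 4 * slabThreshold d ℓ := by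
  unfold slabThreshold
  have h4 : (0 : ℝ) ≤ 4 := by norm_num
  have hℓ : (0 : ℝ) ≤ ℓ := Nat.cast_nonneg ℓ
  have hx : (2 : ℝ) * (2 : ℝ) ^ (1 - ((d + 1 : ℕ) : ℝ)) = (2 : ℝ) ^ (1 - (d : ℝ)) := by
    rw [show (1 : ℝ) - (d : ℝ) = 1 + (1 - ((d + 1 : ℕ) : ℝ)) by push_cast; ring,
      Real.rpow_add (by norm_num : (0 : ℝ) < 2), Real.rpow_one]
  have e1 : (1 - (2 : ℝ) ^ (1 - ((d + 1 : ℕ) : ℝ))) * ((2 : ℕ) : ℝ) =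
      1 + (1 - (2 : ℝ) ^ (1 - (d : ℝ))) := by
    rw [← hx]; push_cast; ring
  have e2 : (2 : ℝ) ^ (1 - ((d + 1 : ℕ) : ℝ)) * ((2 : ℕ) : ℝ) = (2 : ℝ) ^ (1 - (d : ℝ)) := by
    rw [← hx]; push_cast; ring
  rw [mul_pow, ← Real.rpow_natCast ((4 : ℝ) ^ _) 2, ← Real.rpow_natCast ((ℓ : ℝ) ^ _) 2,
    ← Real.rpow_mul h4, ← Real.rpow_mul hℓ, e1, e2, Real.rpow_add (by norm_num : (0 : ℝ) < 4),
    Real.rpow_one]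
  ring

/-- In dimension `2` the threshold is `2√ℓ`: `4^{c_2} h_{ℓ,2} ≤ 2p` forces `ℓ ≤ p²`.
[cite: MaininiSchmidt2020, Lemma 3.6 (proof, d = 2: "for p ≥ √ℓ")] -/
theorem le_sq_of_slabThreshold_two_le {ℓ p : ℕ} (h : slabThreshold 2 ℓ ≤ 2 * p) : ℓ ≤ p ^ 2 := by
  have h1 := slabThreshold_succ_sq 1 ℓ
  have h2 : slabThreshold 1 ℓ = ℓ := by
    unfold slabThreshold
    simp
  rw [h2] at h1
  have h0 := slabThreshold_nonneg 2 ℓ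
  have h3 : slabThreshold 2 ℓ ^ 2 ≤ (2 * p : ℝ) ^ 2 := pow_le_pow_left₀ h0 h 2
  rw [h1] at h3
  have h4 : (ℓ : ℝ) ≤ (p : ℝ) ^ 2 := by nlinarith
  exact_mod_cast h4

/-- One induction step of the threshold: `4^{c_{d+1}} h_{ℓ,d+1} ≤ 2p` implies
`4^{c_d} h_{ℓ,d} ≤ p² ≤ p(p+1)` ([MS20] Lemma 3.6, the display "(2p)²/4 ≥ … = 4^{c_{d−1}} h_{ℓ,d−1}").
[cite: MaininiSchmidt2020, Lemma 3.6 (proof, eq. (kk))] -/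
theorem slabThreshold_le_of_succ {d ℓ p : ℕ} (h : slabThreshold (d + 1) ℓ ≤ 2 * p) :
    slabThreshold d ℓ ≤ p ^ 2 := by
  have h1 := slabThreshold_succ_sq d ℓ
  have h0 := slabThreshold_nonneg (d + 1) ℓ
  have h3 : slabThreshold (d + 1) ℓ ^ 2 ≤ (2 * p : ℝ) ^ 2 := pow_le_pow_left₀ h0 h 2
  rw [h1] at h3
  nlinarith

end Threshold

/-! ### The planar step: an elongated rectangle is beaten by `EIP²` -/

section Planar

/-- **The two-dimensional comparison of [MS20] Lemma 3.6**: a rectangle `a × b` with `a ≥ 1`,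
`b = a + 2p + ε` (`ε ≤ 1`) and `a + p ≤ p²` (i.e. `ℓ ≤ p² + p` for `ℓ = a + 2p`) has more than
`EIP²(ab) = 2⌈2√(ab)⌉` boundary pairs: `2⌈2√(ab)⌉ ≤ 2(a + b) − 2` ("comparing with
`D = {1,…,ℓ−p} × {1,…,ℓ̃−p−1}`"; here via `⌈2√k⌉ ≤ s ⇔ k ≤ ⌊s/2⌋⌈s/2⌉`).
[cite: MaininiSchmidt2020, Lemma 3.6 (proof, case d = 2)] -/
theorem eipValue_two_rect_lt {a p ε : ℕ} (ha : 1 ≤ a) (hε : ε ≤ 1) (hap : a + p ≤ p ^ 2) :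
    eipValue 2 (a * (a + 2 * p + ε)) + 2 ≤ 2 * (a + (a + 2 * p + ε)) := by
  rw [eipValue_two]
  have hs : 1 ≤ a + (a + 2 * p + ε) := by omega
  have h : halfPerim (a * (a + 2 * p + ε)) ≤ a + (a + 2 * p + ε) - 1 := by
    rw [halfPerim_le_iff]
    have h1 := sq_le_four_mul_qsq_add_one (a + (a + 2 * p + ε) - 1)
    -- `4ab + 1 ≤ (a + b − 1)²`
    have h2 : 4 * (a * (a + 2 * p + ε)) + 1 ≤ (a + (a + 2 * p + ε) - 1) ^ 2 := by
      obtain ⟨s, hs'⟩ : ∃ s, a + (a + 2 * p + ε) = s + 1 := ⟨_, (Nat.succ_pred_eq_of_pos hs).symm⟩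
      rw [hs', Nat.add_sub_cancel]
      have hp : 1 ≤ p := by nlinarith
      interval_cases ε
      · have e : s = 2 * a + 2 * p - 1 := by omega
        subst e
        have h6 : 1 ≤ 2 * a + 2 * p := by omega
        zify [h6]
        nlinarith
      · have e : s = 2 * a + 2 * p := by omega
        subst e
        nlinarith
    omega
  omega

end Planar


/-! ### The deficient boxes `P_{ℓ,j,d,q} = {1,…,ℓ−q} × {1,…,ℓ+1}^j × {1,…,ℓ}^{d−1−j}` -/

section Deficient

/-- The edges `(ℓ+1, …, ℓ+1, ℓ, …, ℓ)` (`j` entries `ℓ + 1`, then `ℓ`) of the cross-section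
`{1,…,ℓ+1}^j × {1,…,ℓ}^{m+1−j}` of `P_{ℓ,j,d,2p}` (for `j ≥ m + 1` all entries are `ℓ + 1`).
[cite: MaininiSchmidt2020, Lemma 3.6 (P_{ℓ,j,d,2p})] -/
def hSides (m ℓ j : ℕ) : Fin (m + 1) → ℕ := fun i => if (i : ℕ) < j then ℓ + 1 else ℓ

/-- **The deficient box `P_{ℓ,j,d,q} := {1,…,ℓ−q} × {1,…,ℓ+1}^j × {1,…,ℓ}^{d−1−j} ⊂ ℤ^d`**,
`d = m + 2 ≥ 2`, of [MS20] Lemma 3.6 (there with `q = 2p`; for `j = 0` it is the slab-deficient cube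
`P_{ℓ,d,q}` of Lemma 3.5, `deficientBox_zero_eq_slabConfig`). [cite: MaininiSchmidt2020, Lemma 3.6] -/
def deficientBox (m ℓ j q : ℕ) : Finset (Site (m + 2)) :=
  boxConfig (m + 2) (Fin.cons (ℓ - q) (hSides m ℓ j))

variable {m ℓ j : ℕ}

/-- All cross-section edges are `≥ 1` when `ℓ ≥ 1`. [cite: MaininiSchmidt2020, Lemma 3.6] -/
theorem hSides_pos (hℓ : 1 ≤ ℓ) (m j : ℕ) : ∀ i, 1 ≤ hSides m ℓ j i := by
  intro i; unfold hSides; split_ifs <;> omega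

/-- Dropping the first cross-section edge: the remaining edges are those of `P_{ℓ,j−1,d−1,·}`.
[cite: MaininiSchmidt2020, Lemma 3.6 (the set H = {1,…,ℓ+1}^{j−1} × {1,…,ℓ}^{d−1−j})] -/
theorem tail_hSides (m ℓ j : ℕ) : Fin.tail (hSides (m + 1) ℓ j) = hSides m ℓ (j - 1) := by
  funext i
  simp only [Fin.tail, hSides, Fin.val_succ]
  by_cases h1 : (i : ℕ) + 1 < j
  · rw [if_pos h1, if_pos (by omega)]
  · rw [if_neg h1, if_neg (by omega)]

/-- The first cross-section edge is `ℓ̃ = ℓ + 1` if `j ≥ 1` and `ℓ` if `j = 0`.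
[cite: MaininiSchmidt2020, Lemma 3.6 (proof: "Let ℓ̃ = ℓ+1 if j ≥ 1 and ℓ̃ = ℓ in case j = 0")] -/
theorem hSides_zero (m ℓ j : ℕ) : hSides m ℓ j 0 = ℓ + (if 0 < j then 1 else 0) := by
  unfold hSides
  simp only [Fin.val_zero]
  split_ifs <;> rfl

/-- `hSides (m+1) ℓ j = (ℓ̃, hSides m ℓ (j−1))`. [cite: MaininiSchmidt2020, Lemma 3.6 (P = {1,…,ℓ−2p} × {1,…,ℓ̃} × H)] -/
theorem hSides_succ_eq_cons (m ℓ j : ℕ) :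
    hSides (m + 1) ℓ j = Fin.cons (ℓ + if 0 < j then 1 else 0) (hSides m ℓ (j - 1)) := by
  rw [← hSides_zero (m + 1) ℓ j, ← tail_hSides m ℓ j, Fin.cons_self_tail]

/-- For `j = 0` the deficient box is the slab-deficient cube `P_{ℓ,d,q}` of
`EdgeIsoperimetricFluctuations.lean`. [cite: MaininiSchmidt2020, Lemma 3.5 and Lemma 3.6 (j = 0)] -/
theorem deficientBox_zero_eq_slabConfig (m ℓ q : ℕ) :
    deficientBox m ℓ 0 q = slabConfig (m + 2) ℓ q := by
  unfold deficientBox boxConfig slabConfig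
  have hI : Icc (1 : ℤ) ((ℓ - q : ℕ) : ℤ) = Icc (1 : ℤ) ((ℓ : ℤ) - q) := by
    rcases le_or_gt q ℓ with h | h
    · rw [Nat.cast_sub h]
    · rw [Nat.sub_eq_zero_of_le h.le, Nat.cast_zero, Icc_eq_empty_of_lt (by norm_num),
        Icc_eq_empty_of_lt (by omega)]
  congr 1
  funext i
  refine Fin.cases ?_ (fun i' => ?_) i
  · simpa using hI
  · simp [hSides]

/-- A **block profile** with three blocks: `A` levels of size `v₁`, then `e` levels of size `v₂`,
then one level of size `v₃` (the `e_2`-sections of the configuration `P''` of the proof of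
[MS20] Lemma 3.6, listed by size). [cite: MaininiSchmidt2020, Lemma 3.6 (the configuration P'')] -/
def blockProfile (A e v₁ v₂ v₃ : ℕ) (k : ℕ) : ℕ :=
  if k < A then v₁ else if k < A + e then v₂ else if k < A + e + 1 then v₃ else 0

/-- Summing a function of the level sizes over a block profile.
[cite: MaininiSchmidt2020, Lemma 3.6 (bond count of P'')] -/
theorem sum_blockProfile (φ : ℕ → ℕ) (A e v₁ v₂ v₃ : ℕ) :
    ∑ k ∈ range (A + e + 1), φ (blockProfile A e v₁ v₂ v₃ k) = A * φ v₁ + e * φ v₂ + φ v₃ := by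
  rw [sum_range_succ, sum_range_add]
  have h1 : ∀ k ∈ range A, φ (blockProfile A e v₁ v₂ v₃ k) = φ v₁ := fun k hk => by
    rw [blockProfile, if_pos (mem_range.1 hk)]
  have h2 : ∀ k ∈ range e, φ (blockProfile A e v₁ v₂ v₃ (A + k)) = φ v₂ := fun k hk => by
    have hk := mem_range.1 hk
    rw [blockProfile, if_neg (by omega), if_pos (by omega)]
  have h3 : φ (blockProfile A e v₁ v₂ v₃ (A + e)) = φ v₃ := by
    rw [blockProfile, if_neg (by omega), if_neg (by omega), if_pos (by omega)]
  rw [sum_congr rfl h1, sum_congr rfl h2, h3, sum_const, sum_const, card_range, card_range,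
    smul_eq_mul, smul_eq_mul]

/-- The total number of points of a block profile. [cite: MaininiSchmidt2020, Lemma 3.6 (#P'' = #P)] -/
theorem sum_blockProfile' (A e v₁ v₂ v₃ : ℕ) :
    ∑ k ∈ range (A + e + 1), blockProfile A e v₁ v₂ v₃ k = A * v₁ + e * v₂ + v₃ := by
  simpa using sum_blockProfile id A e v₁ v₂ v₃

/-- A block profile with non-increasing block values is non-increasing. [cite: MaininiSchmidt2020, Lemma 3.6 (P'')] -/
theorem blockProfile_antitone {A e v₁ v₂ v₃ : ℕ} (h12 : v₂ ≤ v₁) (h23 : v₃ ≤ v₂) :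
    Antitone (blockProfile A e v₁ v₂ v₃) := by
  intro a b hab
  simp only [blockProfile]
  split_ifs <;> omega

/-- The block profile vanishes from index `A + e + 1` on. [cite: MaininiSchmidt2020, Lemma 3.6 (P'')] -/
theorem blockProfile_eq_zero {A e v₁ v₂ v₃ k : ℕ} (hk : A + e + 1 ≤ k) :
    blockProfile A e v₁ v₂ v₃ k = 0 := by
  simp only [blockProfile]
  rw [if_neg (by omega), if_neg (by omega), if_neg (by omega)]

/-- The largest level of the block profile (`A ≥ 1`). [cite: MaininiSchmidt2020, Lemma 3.6 (P'')] -/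
theorem blockProfile_zero {A e v₁ v₂ v₃ : ℕ} (hA : 1 ≤ A) : blockProfile A e v₁ v₂ v₃ 0 = v₁ := by
  rw [blockProfile, if_pos (by omega)]

/-- Arithmetic of the three-block profile: total number of points (`b = a + p = w₀ + p²`). [folklore] -/
private theorem deficient_arith₁ {a p w₀ : ℕ} (h5 : 1 ≤ a + p) (hw : w₀ + p ^ 2 = a + p) :
    (a + p - 1) * (a + p) + w₀ = a * (a + 2 * p) := by
  zify [h5] at hw ⊢
  linear_combination hw

/-- Arithmetic of the three-block profile: the cost of the box stack equals `#Θ(P)`. [folklore] -/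
private theorem deficient_arith₂ {a p w₀ ε η θ : ℕ} (h5 : 1 ≤ a + p) (hw : w₀ + p ^ 2 = a + p) :
    2 * ((a + p) * η) + ((a + p - 1) * (2 * η + (a + p) * θ) + ε * (2 * η + a * θ) +
      (2 * η + w₀ * θ)) = 2 * ((a + 2 * p + ε) * η) + a * (2 * η + (a + 2 * p + ε) * θ) := by
  zify [h5] at hw ⊢
  linear_combination (θ : ℤ) * hw

/-- **The planar route** (any dimension `d = m + 2`): if `ℓ ≤ p² + p` (always the case in
dimension `2` under the hypothesis of Lemma 3.6, and the degenerate case "`ℓ − 2p − p(p−1) < 1`"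
of the printed proof otherwise), the rectangle `{1,…,ℓ−2p} × {1,…,ℓ̃}` is beaten by an `EIP²`
minimizer `R'` (`eipValue_two_rect_lt`), and `R' × H` — realised as a sorted stack of boxes
`{1,…,c_t} × H` over the column profile `(c_t)` of `R'` — beats `P_{ℓ,j,d,2p} = R × H`.
[cite: MaininiSchmidt2020, Lemma 3.6 (proof: case d = 2 and "we may assume wlog that ℓ−2p−p(p−1) ≥ 1")] -/
theorem eipValue_deficientBox_lt_of_le {m ℓ j p : ℕ} (hp : 1 ≤ p) (h2p : 2 * p < ℓ)
    (hcase : ℓ ≤ p ^ 2 + p) :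
    eipValue (m + 2) #(deficientBox m ℓ j (2 * p)) <
      #(boundaryPairs (deficientBox m ℓ j (2 * p))) := by
  classical
  -- notation: `a = ℓ − 2p`, `ℓ̃ = ℓ + ε`, cross-section edges `t`, base box `H`
  set ε : ℕ := if 0 < j then 1 else 0 with hε
  have hε1 : ε ≤ 1 := by rw [hε]; split_ifs <;> omega
  set t : Fin m → ℕ := Fin.tail (hSides m ℓ j) with ht
  have hℓ : 1 ≤ ℓ := by omega
  have htpos : ∀ i, 1 ≤ t i := fun i => hSides_pos hℓ m j i.succ
  have hG : hSides m ℓ j = Fin.cons (ℓ + ε) t := by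
    rw [← hSides_zero m ℓ j, ht, Fin.cons_self_tail]
  obtain ⟨a, ha⟩ : ∃ a, ℓ = a + 2 * p := ⟨ℓ - 2 * p, by omega⟩
  have ha1 : 1 ≤ a := by omega
  have hP : deficientBox m ℓ j (2 * p) = boxConfig (m + 2) (Fin.cons a (Fin.cons (a + 2 * p + ε) t)) := by
    rw [deficientBox, hG, ha, Nat.add_sub_cancel, show a + 2 * p + ε = a + 2 * p + ε from rfl]
  set H := boxConfig m t with hH
  set η := #H with hη
  set θ := #(boundaryPairs H) with hθ
  have hη1 : 1 ≤ η := by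
    rw [hη, hH, card_boxConfig]; exact prod_pos fun i _ => Nat.lt_of_succ_le (htpos i)
  -- cardinality and perimeter of the levels `{1,…,w} × H` and of `P`
  have hZcard : ∀ w, #(boxConfig (m + 1) (Fin.cons w t)) = w * η := fun w =>
    card_boxConfig_cons w t
  have hZper : ∀ w, 1 ≤ w → #(boundaryPairs (boxConfig (m + 1) (Fin.cons w t))) = 2 * η + w * θ :=
    fun w hw => card_boundaryPairs_boxConfig_cons hw htpos
  have hPcard : #(deficientBox m ℓ j (2 * p)) = a * ((a + 2 * p + ε) * η) := by
    rw [hP, card_boxConfig_cons, hZcard]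
  have hPper : #(boundaryPairs (deficientBox m ℓ j (2 * p))) =
      2 * ((a + 2 * p + ε) * η) + a * (2 * η + (a + 2 * p + ε) * θ) := by
    have hs : ∀ i : Fin (m + 1), 1 ≤ (Fin.cons (a + 2 * p + ε) t : Fin (m + 1) → ℕ) i :=
      Fin.cases (by simp; omega) (fun i => by simpa using htpos i)
    rw [hP, card_boundaryPairs_boxConfig_cons ha1 hs, hZcard, hZper _ (by omega)]
  -- an optimal planar profile for the rectangle's cardinality
  obtain ⟨D₁, hD₁⟩ := exists_isNestedMinimizerFamily (d := 1) le_rfl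
  obtain ⟨T₂, c, hc, hcT, hcpos, hcsum, hccost⟩ :=
    exists_profileCost_eq_eipValue_succ hD₁ (a * (a + 2 * p + ε))
  have hplanar := eipValue_two_rect_lt ha1 hε1 (p := p) (by nlinarith [hcase])
  have hcost2 : profileCost 1 c T₂ = 2 * c 0 + 2 * T₂ := by
    rw [profileCost_def]
    have : ∀ k ∈ range T₂, eipValue 1 (c k) = 2 := fun k hk =>
      eipValue_one (hcpos k (mem_range.1 hk))
    rw [sum_congr rfl this, sum_const, card_range, smul_eq_mul]
    ring
  -- the stack of the boxes `{1,…,c_k} × H`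
  obtain ⟨D, hD⟩ := exists_isNestedMinimizerFamily (d := m + 1) (by omega)
  set g : ℕ → ℕ := fun k => c k * η with hg
  have hga : Antitone g := fun x y hxy => Nat.mul_le_mul_right η (hc hxy)
  have hgT : g T₂ = 0 := by simp [hg, hcT T₂ le_rfl]
  have hgsum : ∑ k ∈ range T₂, g k = a * ((a + 2 * p + ε) * η) := by
    rw [hg]; simp only; rw [← sum_mul, hcsum]; ring
  have hreal := eipValue_succ_le_profileCost hD hga hgT
  rw [hgsum, profileCost_def] at hreal
  -- bound each level by the box `{1,…,c_k} × H`
  have hlev : ∀ k ∈ range T₂, eipValue (m + 1) (g k) ≤ 2 * η + c k * θ := by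
    intro k hk
    have hck := hcpos k (mem_range.1 hk)
    have h := eipValue_le (boxConfig (m + 1) (Fin.cons (c k) t))
    rwa [hZcard, hZper _ hck] at h
  have hsumlev : ∑ k ∈ range T₂, eipValue (m + 1) (g k) ≤ 2 * η * T₂ + a * (a + 2 * p + ε) * θ := by
    refine (sum_le_sum hlev).trans (le_of_eq ?_)
    rw [sum_add_distrib, sum_const, card_range, smul_eq_mul, ← sum_mul, hcsum]
    ring
  have hg0 : g 0 = c 0 * η := rfl
  rw [hPcard, hPper]
  rw [hg0] at hreal
  -- `eipValue 2 N₁ = 2c(0) + 2T₂ ≤ 2(a + ℓ̃) − 2`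
  have hv2 : 2 * c 0 + 2 * T₂ + 2 ≤ 2 * (a + (a + 2 * p + ε)) := by
    rw [← hcost2, hccost]; exact hplanar
  nlinarith [hreal, hsumlev, hv2, hη1]

/-- **Mainini–Schmidt 2020, Lemma 3.6 (converse slab lemma), every dimension** — in VALUE form.
For `d = m + 2 ≥ 2`, `ℓ`, `j` and `p ≥ 1` with `2p < ℓ` and `2p ≥ 4^{c_d} h_{ℓ,d}`
(`c_d = 1 − 2^{1−d}`, `h_{ℓ,d} = ℓ^{2^{1−d}}`), the deficient box
`P_{ℓ,j,d,2p} = {1,…,ℓ−2p} × {1,…,ℓ+1}^j × {1,…,ℓ}^{d−1−j}` has `EIP^d(#P) < #Θ_d(P)`.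
Printed proof, followed: induction on `d`; the rearrangements `P ↦ P' ↦ P''` (a slab of
thickness `p` moved from the long side onto the short face, then `p(p−1)` `(d−2)`-dimensional
slices moved into the corner) are replaced by the COST of the sorted stack of the `e_2`-sections of
`P''` — `ℓ−p−1` boxes `{1,…,ℓ−p} × H`, `ℓ̃ − ℓ` boxes `{1,…,ℓ−2p} × H` and one box
`{1,…,ℓ−p−p²} × H` (`blockProfile`, `eipValue_succ_le_profileCost` over the nested minimizers of
`GridEdgeIsoperimetry.lean`) — whose total is exactly `#Θ_d(P)`; the last face is the deficient box
`P_{ℓ,j−1,d−1,p²+p}`, NOT an `EIP^{d−1}` minimizer by induction since `p² ≥ 4^{c_{d−1}} h_{ℓ,d−1}`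
(`slabThreshold_le_of_succ`), which makes the inequality strict ([MS20] uses Corollary 3.3 at this
point).  The degenerate case `ℓ − p − p² < 1` and the base `d = 2` are `eipValue_deficientBox_lt_of_le`.
The hypothesis `2p < ℓ` (`P ≠ ∅`) is implicit in the source (for `2p ≥ ℓ` the set is empty and a
minimizer by convention). [cite: MaininiSchmidt2020, Lemma 3.6] -/
theorem eipValue_deficientBox_lt (m : ℕ) :
    ∀ ℓ j p : ℕ, 1 ≤ p → 2 * p < ℓ → slabThreshold (m + 2) ℓ ≤ 2 * p →
      eipValue (m + 2) #(deficientBox m ℓ j (2 * p)) <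
        #(boundaryPairs (deficientBox m ℓ j (2 * p))) := by
  classical
  induction m with
  | zero =>
    intro ℓ j p hp h2p hthr
    exact eipValue_deficientBox_lt_of_le hp h2p
      ((le_sq_of_slabThreshold_two_le hthr).trans (Nat.le_add_right _ _))
  | succ m ih =>
    intro ℓ j p hp h2p hthr
    by_cases hcase : ℓ ≤ p ^ 2 + p
    · exact eipValue_deficientBox_lt_of_le hp h2p hcase
    -- the three-block route
    push Not at hcase
    set ε : ℕ := if 0 < j then 1 else 0 with hε
    have hε1 : ε ≤ 1 := by rw [hε]; split_ifs <;> omega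
    have hℓ : 1 ≤ ℓ := by omega
    set t : Fin (m + 1) → ℕ := hSides m ℓ (j - 1) with ht
    have htpos : ∀ i, 1 ≤ t i := hSides_pos hℓ m (j - 1)
    have hG : hSides (m + 1) ℓ j = Fin.cons (ℓ + ε) t := hSides_succ_eq_cons m ℓ j
    -- `ℓ = a + 2p`, `b = ℓ − p = a + p`, `2p' = p(p+1)`, `w₀ = ℓ − 2p' = b − p²`
    obtain ⟨a, ha⟩ : ∃ a, ℓ = a + 2 * p := ⟨ℓ - 2 * p, by omega⟩
    have ha1 : 1 ≤ a := by omega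
    obtain ⟨p', hp'⟩ := Nat.even_mul_succ_self p
    have hpp : p ^ 2 + p = 2 * p' := by rw [sq]; linarith [hp']
    have hp'1 : 1 ≤ p' := by nlinarith only [hp', hp]
    have h2p' : 2 * p' < ℓ := by omega
    obtain ⟨w₀, hw₀⟩ : ∃ w₀, ℓ = w₀ + 2 * p' := ⟨ℓ - 2 * p', by omega⟩
    have hw₀1 : 1 ≤ w₀ := by omega
    -- the induction hypothesis: the face `{1,…,w₀} × H = P_{ℓ,j−1,d−1,2p'}` is beaten
    have hthr' : slabThreshold (m + 2) ℓ ≤ 2 * p' := by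
      have h1 := slabThreshold_le_of_succ hthr
      have h2 : ((p ^ 2 : ℕ) : ℝ) ≤ ((2 * p' : ℕ) : ℝ) := by exact_mod_cast (by omega : p ^ 2 ≤ 2 * p')
      push_cast at h1 h2 ⊢
      linarith
    have hIH := ih ℓ (j - 1) p' hp'1 h2p' hthr'
    have hZ₀ : deficientBox m ℓ (j - 1) (2 * p') = boxConfig (m + 2) (Fin.cons w₀ t) := by
      rw [deficientBox, ht, hw₀, Nat.add_sub_cancel]
    rw [hZ₀] at hIH
    -- the set `P` and the base box `H`
    have hP : deficientBox (m + 1) ℓ j (2 * p) =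
        boxConfig (m + 3) (Fin.cons a (Fin.cons (a + 2 * p + ε) t)) := by
      rw [deficientBox, hG, ha, Nat.add_sub_cancel]
    set H := boxConfig (m + 1) t with hH
    set η := #H with hη
    set θ := #(boundaryPairs H) with hθ
    have hZcard : ∀ w, #(boxConfig (m + 2) (Fin.cons w t)) = w * η := fun w =>
      card_boxConfig_cons w t
    have hZper : ∀ w, 1 ≤ w → #(boundaryPairs (boxConfig (m + 2) (Fin.cons w t))) = 2 * η + w * θ :=
      fun w hw => card_boundaryPairs_boxConfig_cons hw htpos
    have hPcard : #(deficientBox (m + 1) ℓ j (2 * p)) = a * ((a + 2 * p + ε) * η) := by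
      rw [hP, card_boxConfig_cons, hZcard]
    have hPper : #(boundaryPairs (deficientBox (m + 1) ℓ j (2 * p))) =
        2 * ((a + 2 * p + ε) * η) + a * (2 * η + (a + 2 * p + ε) * θ) := by
      have hs : ∀ i : Fin (m + 2), 1 ≤ (Fin.cons (a + 2 * p + ε) t : Fin (m + 2) → ℕ) i :=
        Fin.cases (by simp; omega) (fun i => by simpa using htpos i)
      rw [hP, card_boundaryPairs_boxConfig_cons ha1 hs, hZcard, hZper _ (by omega)]
    rw [hZcard, hZper _ hw₀1] at hIH
    -- the block profile: `a + p − 1` levels `(a+p)η`, `ε` levels `aη`, one level `w₀η`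
    set g := blockProfile (a + p - 1) ε ((a + p) * η) (a * η) (w₀ * η) with hg
    have hw₀a : w₀ ≤ a := by nlinarith only [hw₀, hpp, ha, hp]
    have hga : Antitone g :=
      blockProfile_antitone (Nat.mul_le_mul_right η (by omega)) (Nat.mul_le_mul_right η hw₀a)
    have hgT : g (a + p - 1 + ε + 1) = 0 := blockProfile_eq_zero le_rfl
    obtain ⟨D, hD⟩ := exists_isNestedMinimizerFamily (d := m + 2) (by omega)
    have hreal := eipValue_succ_le_profileCost hD hga hgT
    rw [profileCost_def, hg, sum_blockProfile', sum_blockProfile (eipValue (m + 2)),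
      blockProfile_zero (by omega)] at hreal
    -- the total of the profile is `#P`
    have h5 : 1 ≤ a + p := by omega
    have hw : w₀ + p ^ 2 = a + p := by linarith only [hw₀, hpp, ha]
    have hsum : (a + p - 1) * ((a + p) * η) + ε * (a * η) + w₀ * η = a * ((a + 2 * p + ε) * η) := by
      have hkey := deficient_arith₁ h5 hw
      calc (a + p - 1) * ((a + p) * η) + ε * (a * η) + w₀ * η
          = ((a + p - 1) * (a + p) + w₀) * η + ε * (a * η) := by ring
        _ = a * (a + 2 * p) * η + ε * (a * η) := by rw [hkey]
        _ = a * ((a + 2 * p + ε) * η) := by ring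
    rw [hsum] at hreal
    -- bound the levels by boxes; the last one strictly, by induction
    have hl1 : eipValue (m + 2) ((a + p) * η) ≤ 2 * η + (a + p) * θ := by
      have h := eipValue_le (boxConfig (m + 2) (Fin.cons (a + p) t))
      rwa [hZcard, hZper _ (by omega)] at h
    have hl2 : eipValue (m + 2) (a * η) ≤ 2 * η + a * θ := by
      have h := eipValue_le (boxConfig (m + 2) (Fin.cons a t))
      rwa [hZcard, hZper _ ha1] at h
    rw [hPcard, hPper]
    -- the perimeter identity `cost of the stack with boxes = #Θ(P)`
    have hid : 2 * ((a + p) * η) + ((a + p - 1) * (2 * η + (a + p) * θ) + ε * (2 * η + a * θ) +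
        (2 * η + w₀ * θ)) = 2 * ((a + 2 * p + ε) * η) + a * (2 * η + (a + 2 * p + ε) * θ) :=
      deficient_arith₂ h5 hw
    have hA := Nat.mul_le_mul_left (a + p - 1) hl1
    have hE := Nat.mul_le_mul_left ε hl2
    rw [show m + 2 + 1 = m + 1 + 2 by omega] at hreal
    linarith only [hreal, hA, hE, hIH, hid]

/-- **[MS20] Lemma 3.6 as printed: `P_{ℓ,j,d,2p}` is not an `EIP^d` minimizer** when
`2p ≥ 4^{c_d} h_{ℓ,d}` (`d ≥ 2`, `p ≥ 1`, `2p < ℓ` so that the set is non-empty).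
[cite: MaininiSchmidt2020, Lemma 3.6] -/
theorem not_isEIPMinimizer_deficientBox {m ℓ j p : ℕ} (hp : 1 ≤ p) (h2p : 2 * p < ℓ)
    (hthr : slabThreshold (m + 2) ℓ ≤ 2 * p) : ¬ IsEIPMinimizer (deficientBox m ℓ j (2 * p)) := by
  intro hmin
  have h := eipValue_deficientBox_lt m ℓ j p hp h2p hthr
  rw [hmin.card_boundaryPairs_eq rfl] at h
  exact lt_irrefl _ h

/-- The case `j = 0` in the vocabulary of `EdgeIsoperimetricFluctuations.lean`: the slab-deficient
cube `P_{ℓ,d,2p} = {1,…,ℓ−2p} × {1,…,ℓ}^{d−1}` (`slabConfig`) is NOT an `EIP^d` minimizer once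
`2p ≥ 4^{c_d} h_{ℓ,d}` — the converse of Lemma 3.5 (`MaininiSchmidt2020_lemma35`: it IS one for
`p ≤ ⌊h_{ℓ,d}⌋`). [cite: MaininiSchmidt2020, Lemma 3.6 (j = 0) and Lemma 3.5] -/
theorem not_isEIPMinimizer_slabConfig_of_le {d ℓ p : ℕ} (hd : 2 ≤ d) (hp : 1 ≤ p)
    (h2p : 2 * p < ℓ)
    (hthr : (4 : ℝ) ^ (1 - (2 : ℝ) ^ (1 - (d : ℝ))) * (ℓ : ℝ) ^ ((2 : ℝ) ^ (1 - (d : ℝ))) ≤ 2 * p) :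
    ¬ IsEIPMinimizer (slabConfig d ℓ (2 * p)) := by
  obtain ⟨m, rfl⟩ : ∃ m, d = m + 2 := ⟨d - 2, by omega⟩
  rw [← deficientBox_zero_eq_slabConfig]
  exact not_isEIPMinimizer_deficientBox hp h2p hthr

end Deficient

end Literature.MathematicalPhysics.StatisticalMechanics
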